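import Mathlib
import Summits.Schanuel.Schanuel.Theses.RigidCore
import Literature.NumberTheory.Transcendental.ZilberFieldExistenceProofs

/-!
# Crux `MinimalCounterexampleInAcl` (stmt-Schanuel-0969) — a locus mate cannot gain transcendence degree

Support for the PICKED line `kernel-arithmetic-selection` (first half of `stub_mateFirstFailure`: a mate
of a first failure is again a first failure) and for `span-growth-dichotomy` (Stub T1 `stub_matePredim`),
landed by the crux disprover (`--supports`).  All PROVED:

* `algebraicIndependent_of_relations` — if `x'` satisfies every ℚ-relation of `(x, eˣ)` then every
  algebraically independent sub-family of `(x', e^{x'})` (indexed through any `f : ι → Fin n ⊕ Fin n`)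
  is algebraically independent for `(x, eˣ)` at the same indices (`MvPolynomial.rename`);
* `natCast_le_trdeg_of_relations` — hence `m ≤ trdeg ℚ(x', e^{x'}) ⟹ m ≤ trdeg ℚ(x, eˣ)` for every
  natural `m` (rank in the algebraic matroid: an independent subset of `x' ∪ e^{x'}` pulls back to an
  independent subset of `x ∪ eˣ` of the same size);
* `mate_trdeg_lt` — **a locus mate of a counterexample tuple is a counterexample tuple**:
  `trdeg ℚ(x, eˣ) < n ⟹ trdeg ℚ(x', e^{x'}) < n`; with the ranks below `n` this is the "mates of first
  failures are first failures" half of `stub_mateFirstFailure` (`mate_firstFailure`).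

## References

* J. Kirby, *Exponential algebraicity in exponential fields*, Bull. LMS 42 (2010), arXiv:0810.4285, §1.
-/

noncomputable section

set_option linter.dupNamespace false

open Complex Set
open Literature.NumberTheory.Transcendental

namespace Summit.Schanuel.Schanuel.Theorems.MinimalCounterexampleInAcl.Negative

/-- **Relations transfer algebraic independence backwards**: if `x'` satisfies every ℚ-relation of
`(x, eˣ)`, an algebraically independent sub-family of `(x', e^{x'})` is algebraically independent for
`(x, eˣ)` at the same indices. [folklore] -/
theorem algebraicIndependent_of_relations {n : ℕ} {x x' : Fin n → ℂ}
    (hrel : ∀ p : MvPolynomial (Fin n ⊕ Fin n) ℚ,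
      MvPolynomial.aeval (Sum.elim x (cexp ∘ x)) p = 0 →
      MvPolynomial.aeval (Sum.elim x' (cexp ∘ x')) p = 0)
    {ι : Type*} (f : ι → Fin n ⊕ Fin n)
    (hind : AlgebraicIndependent ℚ (Sum.elim x' (cexp ∘ x') ∘ f)) :
    AlgebraicIndependent ℚ (Sum.elim x (cexp ∘ x) ∘ f) := by
  rw [algebraicIndependent_iff] at hind ⊢
  intro P hP
  refine hind P ?_
  have h1 : MvPolynomial.aeval (Sum.elim x (cexp ∘ x)) (MvPolynomial.rename f P) = 0 := by
    rw [MvPolynomial.aeval_rename]; exact hP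
  have h2 := hrel _ h1
  rwa [MvPolynomial.aeval_rename] at h2

/-- Hence the transcendence degree cannot go up along relations:
`m ≤ trdeg ℚ(x', e^{x'}) ⟹ m ≤ trdeg ℚ(x, eˣ)` for every natural `m`. [folklore] -/
theorem natCast_le_trdeg_of_relations {n : ℕ} {x x' : Fin n → ℂ}
    (hrel : ∀ p : MvPolynomial (Fin n ⊕ Fin n) ℚ,
      MvPolynomial.aeval (Sum.elim x (cexp ∘ x)) p = 0 →
      MvPolynomial.aeval (Sum.elim x' (cexp ∘ x')) p = 0)
    {m : ℕ}
    (hm : (m : Cardinal) ≤ Algebra.trdeg ℚ ↥(IntermediateField.adjoin ℚ (range x' ∪ range (cexp ∘ x')))) :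
    (m : Cardinal) ≤ Algebra.trdeg ℚ ↥(IntermediateField.adjoin ℚ (range x ∪ range (cexp ∘ x))) := by
  classical
  set v : Fin n ⊕ Fin n → ℂ := Sum.elim x (cexp ∘ x) with hv
  set v' : Fin n ⊕ Fin n → ℂ := Sum.elim x' (cexp ∘ x') with hv'
  have hS : range x ∪ range (cexp ∘ x) = range v := by rw [hv, Set.Sum.elim_range]
  have hS' : range x' ∪ range (cexp ∘ x') = range v' := by rw [hv', Set.Sum.elim_range]
  rw [hS] at ⊢
  rw [hS'] at hm
  -- an independent subset `J` of `range v'` of size `m`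
  have hm' : (m : ℕ∞) ≤ (GammaField.algMatroid ℂ).eRk (range v') :=
    ZilberHomogeneity.natCast_le_eRk_of_le_trdeg hm
  obtain ⟨J, hJsub, hJind, hJcard⟩ := Matroid.le_eRk_iff.1 hm'
  -- index it
  have hpre : ∀ j : J, ∃ i : Fin n ⊕ Fin n, v' i = (j : ℂ) := fun j => hJsub j.2
  choose f hf using hpre
  have hvf : v' ∘ f = (Subtype.val : J → ℂ) := funext hf
  have hJind' : AlgebraicIndependent ℚ (v' ∘ f) := by
    rw [hvf]
    exact (AlgebraicIndependent.matroid_indep_iff.1 hJind)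
  -- transfer to `v`
  have hind : AlgebraicIndependent ℚ (v ∘ f) := algebraicIndependent_of_relations hrel f hJind'
  have hinj : Function.Injective (v ∘ f) := hind.injective
  have hI : (GammaField.algMatroid ℂ).Indep (range (v ∘ f)) :=
    AlgebraicIndependent.matroid_indep_iff.2 hind.to_subtype_range
  have hIsub : range (v ∘ f) ⊆ range v := by
    rintro a ⟨j, rfl⟩; exact ⟨f j, rfl⟩
  have hcard : (range (v ∘ f)).encard = m := by
    rw [← hJcard, ← Set.image_univ, hinj.encard_image, Set.encard_univ]
    simp
  have hle : (m : ℕ∞) ≤ (GammaField.algMatroid ℂ).eRk (range v) := by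
    rw [← hcard]; exact hI.encard_le_eRk_of_subset hIsub
  exact le_trdeg_adjoin_of_natCast_le_eRk hle

/-- **A locus mate of a counterexample tuple is a counterexample tuple**: if `trdeg ℚ(x, eˣ) < n` and
`x'` satisfies every ℚ-relation of `(x, eˣ)`, then `trdeg ℚ(x', e^{x'}) < n`. [folklore] -/
theorem mate_trdeg_lt {n : ℕ} {x x' : Fin n → ℂ}
    (htr : Algebra.trdeg ℚ ↥(IntermediateField.adjoin ℚ (range x ∪ range (cexp ∘ x))) < (n : Cardinal))
    (hrel : ∀ p : MvPolynomial (Fin n ⊕ Fin n) ℚ,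
      MvPolynomial.aeval (Sum.elim x (cexp ∘ x)) p = 0 →
      MvPolynomial.aeval (Sum.elim x' (cexp ∘ x')) p = 0) :
    Algebra.trdeg ℚ ↥(IntermediateField.adjoin ℚ (range x' ∪ range (cexp ∘ x'))) < (n : Cardinal) := by
  by_contra h
  exact (not_le.2 htr) (natCast_le_trdeg_of_relations hrel (not_lt.1 h))

/-- **Mates of first failures are first failures** (first half of `stub_mateFirstFailure`, for every
rank): a ℚ-linearly independent `x'` satisfying the relations of a first failure `x` is a first failure
of the same rank. [cite: Kirby2010, §1] -/
theorem mate_firstFailure {n : ℕ} {x x' : Fin n → ℂ}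
    (hx : LinearIndependent ℚ x ∧
      Algebra.trdeg ℚ ↥(IntermediateField.adjoin ℚ (range x ∪ range (cexp ∘ x))) < (n : Cardinal) ∧
      ∀ r < n, SchanuelRank r)
    (hx' : LinearIndependent ℚ x' ∧ ∀ p : MvPolynomial (Fin n ⊕ Fin n) ℚ,
      MvPolynomial.aeval (Sum.elim x (cexp ∘ x)) p = 0 →
      MvPolynomial.aeval (Sum.elim x' (cexp ∘ x')) p = 0) :
    LinearIndependent ℚ x' ∧
      Algebra.trdeg ℚ ↥(IntermediateField.adjoin ℚ (range x' ∪ range (cexp ∘ x'))) < (n : Cardinal) ∧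
      ∀ r < n, SchanuelRank r :=
  ⟨hx'.1, mate_trdeg_lt hx.2.1 hx'.2, hx.2.2⟩

end Summit.Schanuel.Schanuel.Theorems.MinimalCounterexampleInAcl.Negative

end
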